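import Mathlib
import HarnessLib
import Literature.Analysis.FluidPDE.Tao2016AveragedNS.LocalCascadeSolutions
import Literature.Analysis.FluidPDE.Tao2016AveragedNS.RenormalisedCascadeWaves
import Literature.Analysis.FluidPDE.Tao2016AveragedNS.ViscousEternalSolutions
import Literature.Analysis.FluidPDE.Tao2016AveragedNS.BoundedEternalSolutions

/-!
# Crux K1ᵛ(1) `TaoLadderRungTwoBreak.NoSurvivingEternalViscBddOne` (stmt-NavierStokesRegularity-20419):
# PAST-LOCAL SLAVING of a shell to the shell below, for admissible eternal solutions with covariant
# viscosity `ν̂ ≥ 0` (part 1 of the TAIL BARRIER)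

MODEL lattice ODEs only (Tao 2016 §4 in the self-similar log-time variables of §6.4); nothing in this file
is a statement about the Navier–Stokes equations, and no summit or rung LEAF is proved by it
(`--supports stmt-NavierStokesRegularity-20419 --as helper`).  General `m`, any table with the
cancellation (4.3), every `ε₀ > 0`, every covariant viscosity `ν̂ ≥ 0` (so both split children (ρ0)
`ν̂ = 0` and (ρ+) `ν̂ > 0` of the crux are covered); `C_A = fluxConst α`, `Λ = bigLam ε₀`.

The renormalised frame carries the damping `-W_k` (the type-I weight `e^{σ}`).  Keeping part of it in
the weight gives the weighted shell energy identity
`(e^{cσ}‖W_k‖²)' = e^{cσ}((c-2)‖W_k‖² + 2Λ⟪W_k, A W_{k-1}⟫ - 2Λ⁻¹⟪W_{k+1}, A W_k⟫ - 2·visc·‖W_k‖²)`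
(`hasDerivAt_expWeight`; `c = 2` is the tree's `hasDerivAt_renE`).  With `c = 1`:

* `bracket_le` / `bracket_le_of_flux_nonneg` — pointwise: if `‖W_{k-1}‖ ≤ M` and EITHER the shell above
  obeys the backscatter margin `4 C_A ‖W_{k+1}‖ ≤ Λ` (the back-reaction eats at most half the damping)
  OR the bond above does not backscatter (`⟪W_{k+1}, A W_k⟫ ≥ 0`), the half-damped bracket is `≤ (2ΛC_AM²)²`;
* `norm_le_of_bracket_le` — THE FENCE: a bracket bound `≤ b²` on `(-∞, σ₁]` and boundedness of the shell in
  the past give `‖W_k‖ ≤ b` on `(-∞, σ₁]` (`e^{σ}‖W_k‖² - b²e^{σ}` is antitone and is released from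
  `σ → -∞` by ETERNITY — the far past costs nothing because the shell is bounded there);
* `norm_le_slaved` / `norm_le_slaved_of_flux_nonneg` — SLAVING TO THE SHELL BELOW: `‖W_k(σ)‖ ≤ 2 Λ C_A M²`
  on `(-∞, σ₁]`.  No sign hypothesis (margin form), no smallness of the solution, no comparability,
  constants uniform in the shell and in `ν̂`;
* `normSq_le_add_mul` — the sign-free growth bound `‖W_k(r)‖² ≤ ‖W_k(x)‖² + 2 C_A (Λ + Λ⁻¹) B³ (r - x)`
  under the uniform bound `B` (the dissipation has a sign), uniform in the shell — the time step of the
  barrier over infinitely many shells, where no uniform Lipschitz bound exists for `ν̂ > 0`.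

Part 2 (`…TailBarrier`) runs the real induction: tail barrier, ordered ignition, doubly-exponential
leading edge, and the unconditional `ν̂ > 0` version.  HONEST LABEL: structure lemmas for the objects the
Liouville crux quantifies over; `stub_noSurvivingEternalBddOne`, `stub_noLoudLadderOne` and ⟨20419⟩ stay
OPEN; rung 0.
-/

noncomputable section

-- the summit and its single sub-problem share the name (CONVENTIONS §1)
set_option linter.dupNamespace false

namespace Summit.NavierStokesRegularity.NavierStokesRegularity.Theorems.NoSurvivingEternalViscBddOne.TailBarrier

open Set Filter Topology
open scoped RealInnerProductSpace
open Literature.Analysis.FluidPDE Literature.Analysis.FluidPDE.TaoCascade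

variable {m : ℕ} {ε₀ νh : ℝ} {α : Fin m → Fin m → Fin m → ℤ × ℤ × ℤ → ℝ} {W : ℤ → ℝ → Em m}

/-! ## The weighted shell energy identities -/

/-- **Weighted shell energy identity** with weight `e^{cσ}`: `(e^{cσ}‖W_k‖²)' =
e^{cσ}((c-2)‖W_k‖² + 2Λ⟪W_k, A W_{k-1}⟫ - 2Λ⁻¹⟪W_{k+1}, A W_k⟫ - 2·viscCoef·‖W_k‖²)` — the tree's identity
`hasDerivAt_renE` (weight `e^{2σ}`, cancellation (4.3)) transported to an arbitrary exponential weight.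
[cite: Tao2016AveragedNS, §4 Lemma 4.1 (4.8)–(4.10) with (4.3) and the viscous equation displayed before Thm. 4.2, shell-wise in the self-similar variables of §6.4] -/
theorem hasDerivAt_expWeight (hW : IsEternalVisc ε₀ νh α W) (hc : IsCancellingCoeff α) (c : ℝ)
    (k : ℤ) (σ : ℝ) :
    HasDerivAt (fun x => Real.exp (c * x) * ‖W k x‖ ^ 2)
      (Real.exp (c * σ) * ((c - 2) * ‖W k σ‖ ^ 2 + 2 * bigLam ε₀ * ⟪W k σ, tableA α (W (k - 1) σ)⟫
        - 2 * (bigLam ε₀)⁻¹ * ⟪W (k + 1) σ, tableA α (W k σ)⟫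
        - 2 * viscCoef ε₀ νh k σ * ‖W k σ‖ ^ 2)) σ := by
  have h1 : HasDerivAt (fun x => Real.exp ((c - 2) * x)) (Real.exp ((c - 2) * σ) * (c - 2)) σ := by
    have h := ((hasDerivAt_id σ).const_mul (c - 2)).exp
    simpa only [id_eq, mul_one] using h
  have h2 := h1.mul (hasDerivAt_renE hW hc k σ)
  have he : ∀ x, Real.exp ((c - 2) * x) * Real.exp (2 * x) = Real.exp (c * x) := fun x => by
    rw [← Real.exp_add]; congr 1; ring
  have hfun : (fun x => Real.exp (c * x) * ‖W k x‖ ^ 2)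
      = fun x => Real.exp ((c - 2) * x) * (Real.exp (2 * x) * ‖W k x‖ ^ 2) := by
    funext x; rw [← mul_assoc, he x]
  rw [hfun]
  refine h2.congr_deriv ?_
  rw [← he σ]
  ring

/-- **Pointwise bracket bound under a backscatter margin.**  If `‖W_{k-1}(σ)‖ ≤ M` and the shell above obeys
`4 C_A ‖W_{k+1}(σ)‖ ≤ Λ`, then the half-damped bracket is at most `b²` with `b = 2 Λ C_A M²`:
`-‖W_k‖² + 2Λ⟪W_k, A W_{k-1}⟫ - 2Λ⁻¹⟪W_{k+1}, A W_k⟫ - 2·visc·‖W_k‖² ≤ (2ΛC_A M²)²`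
(feed `≤ 2ΛC_A M²‖W_k‖`, back-reaction `≤ ½‖W_k‖²`, dissipation `≤ 0`, and `-u²/2 + bu ≤ b²`).
[cite: Tao2016AveragedNS, §4 (4.1), (4.3), Lemma 4.1 (4.8); §6.4] -/
theorem bracket_le (hε : 0 < ε₀) (hν : 0 ≤ νh) (hc : IsCancellingCoeff α) {k : ℤ} {σ M : ℝ}
    (hM : ‖W (k - 1) σ‖ ≤ M) (hmar : 4 * fluxConst α * ‖W (k + 1) σ‖ ≤ bigLam ε₀) :
    -‖W k σ‖ ^ 2 + 2 * bigLam ε₀ * ⟪W k σ, tableA α (W (k - 1) σ)⟫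
        - 2 * (bigLam ε₀)⁻¹ * ⟪W (k + 1) σ, tableA α (W k σ)⟫
        - 2 * viscCoef ε₀ νh k σ * ‖W k σ‖ ^ 2
      ≤ (2 * bigLam ε₀ * fluxConst α * M ^ 2) ^ 2 := by
  have hS := table_sTable α hc
  have hΛ : 0 < bigLam ε₀ := bigLam_pos (by linarith)
  have hCA : 0 ≤ fluxConst α := fluxConst_nonneg α
  set u : ℝ := ‖W k σ‖ with hu
  have hu0 : 0 ≤ u := norm_nonneg _
  -- feed term
  have hfeed : ⟪W k σ, tableA α (W (k - 1) σ)⟫ ≤ u * (fluxConst α * M ^ 2) := by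
    calc ⟪W k σ, tableA α (W (k - 1) σ)⟫ ≤ ‖W k σ‖ * ‖tableA α (W (k - 1) σ)‖ :=
          real_inner_le_norm _ _
      _ ≤ u * (fluxConst α * ‖W (k - 1) σ‖ ^ 2) :=
          mul_le_mul_of_nonneg_left (hS.normA _) hu0
      _ ≤ u * (fluxConst α * M ^ 2) := by
          apply mul_le_mul_of_nonneg_left _ hu0
          exact mul_le_mul_of_nonneg_left (pow_le_pow_left₀ (norm_nonneg _) hM 2) hCA
  -- back-reaction term
  have hback : -⟪W (k + 1) σ, tableA α (W k σ)⟫ ≤ ‖W (k + 1) σ‖ * (fluxConst α * u ^ 2) := by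
    calc -⟪W (k + 1) σ, tableA α (W k σ)⟫ ≤ |⟪W (k + 1) σ, tableA α (W k σ)⟫| := neg_le_abs _
      _ ≤ ‖W (k + 1) σ‖ * ‖tableA α (W k σ)‖ := abs_real_inner_le_norm _ _
      _ ≤ ‖W (k + 1) σ‖ * (fluxConst α * u ^ 2) :=
          mul_le_mul_of_nonneg_left (hS.normA _) (norm_nonneg _)
  have hback' : -(2 * (bigLam ε₀)⁻¹ * ⟪W (k + 1) σ, tableA α (W k σ)⟫) ≤ u ^ 2 / 2 := by
    have h1 : -(2 * (bigLam ε₀)⁻¹ * ⟪W (k + 1) σ, tableA α (W k σ)⟫)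
        = 2 * (bigLam ε₀)⁻¹ * (-⟪W (k + 1) σ, tableA α (W k σ)⟫) := by ring
    rw [h1]
    have h2 : 2 * (bigLam ε₀)⁻¹ * (-⟪W (k + 1) σ, tableA α (W k σ)⟫)
        ≤ 2 * (bigLam ε₀)⁻¹ * (‖W (k + 1) σ‖ * (fluxConst α * u ^ 2)) :=
      mul_le_mul_of_nonneg_left hback (by positivity)
    refine h2.trans ?_
    have h3 : fluxConst α * ‖W (k + 1) σ‖ ≤ bigLam ε₀ / 4 := by
      rw [le_div_iff₀ (by norm_num : (0:ℝ) < 4)]; linarith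
    have h4 : 2 * (bigLam ε₀)⁻¹ * (‖W (k + 1) σ‖ * (fluxConst α * u ^ 2))
        = 2 * (bigLam ε₀)⁻¹ * (fluxConst α * ‖W (k + 1) σ‖) * u ^ 2 := by ring
    rw [h4]
    have h5 : 2 * (bigLam ε₀)⁻¹ * (fluxConst α * ‖W (k + 1) σ‖) ≤ 2 * (bigLam ε₀)⁻¹ * (bigLam ε₀ / 4) :=
      mul_le_mul_of_nonneg_left h3 (by positivity)
    have h6 : 2 * (bigLam ε₀)⁻¹ * (bigLam ε₀ / 4) = 1 / 2 := by
      field_simp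
      ring
    calc 2 * (bigLam ε₀)⁻¹ * (fluxConst α * ‖W (k + 1) σ‖) * u ^ 2
        ≤ 2 * (bigLam ε₀)⁻¹ * (bigLam ε₀ / 4) * u ^ 2 :=
          mul_le_mul_of_nonneg_right h5 (by positivity)
      _ = u ^ 2 / 2 := by rw [h6]; ring
  -- dissipation term
  have hvisc : 0 ≤ 2 * viscCoef ε₀ νh k σ * ‖W k σ‖ ^ 2 := by
    have hvc : 0 ≤ viscCoef ε₀ νh k σ := by
      unfold viscCoef
      have : 0 < (1 + ε₀) ^ ((2 : ℝ) * k) := Real.rpow_pos_of_pos (by linarith) _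
      positivity
    positivity
  set b : ℝ := 2 * bigLam ε₀ * fluxConst α * M ^ 2 with hb
  have hb0 : 0 ≤ b := by positivity
  have hfeed' : 2 * bigLam ε₀ * ⟪W k σ, tableA α (W (k - 1) σ)⟫ ≤ b * u := by
    have := mul_le_mul_of_nonneg_left hfeed (by positivity : (0:ℝ) ≤ 2 * bigLam ε₀)
    calc 2 * bigLam ε₀ * ⟪W k σ, tableA α (W (k - 1) σ)⟫
        ≤ 2 * bigLam ε₀ * (u * (fluxConst α * M ^ 2)) := this
      _ = b * u := by rw [hb]; ring
  have hnorm : ‖W k σ‖ ^ 2 = u ^ 2 := by rw [hu]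
  rw [hnorm]
  nlinarith [sq_nonneg (u - b), hfeed', hback', hvisc]

/-- **Pointwise bracket bound, upward-flux form**: if `‖W_{k-1}(σ)‖ ≤ M` and the bond above does not
backscatter at `σ` (`⟪W_{k+1}, A W_k⟫ ≥ 0`, automatic on Kamke / strong-orthant tables), the half-damped
bracket is at most `(2ΛC_A M²)²` — no margin needed.
[cite: Tao2016AveragedNS, §4 (4.1), (4.3), Lemma 4.1 (4.8)–(4.9); §1.2 (energy flows from mode `n` to mode `n+1`)] -/
theorem bracket_le_of_flux_nonneg (hε : 0 < ε₀) (hν : 0 ≤ νh) (hc : IsCancellingCoeff α) {k : ℤ}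
    {σ M : ℝ} (hM : ‖W (k - 1) σ‖ ≤ M) (hflux : 0 ≤ ⟪W (k + 1) σ, tableA α (W k σ)⟫) :
    -‖W k σ‖ ^ 2 + 2 * bigLam ε₀ * ⟪W k σ, tableA α (W (k - 1) σ)⟫
        - 2 * (bigLam ε₀)⁻¹ * ⟪W (k + 1) σ, tableA α (W k σ)⟫
        - 2 * viscCoef ε₀ νh k σ * ‖W k σ‖ ^ 2
      ≤ (2 * bigLam ε₀ * fluxConst α * M ^ 2) ^ 2 := by
  have hS := table_sTable α hc
  have hΛ : 0 < bigLam ε₀ := bigLam_pos (by linarith)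
  have hCA : 0 ≤ fluxConst α := fluxConst_nonneg α
  set u : ℝ := ‖W k σ‖ with hu
  have hu0 : 0 ≤ u := norm_nonneg _
  have hfeed : ⟪W k σ, tableA α (W (k - 1) σ)⟫ ≤ u * (fluxConst α * M ^ 2) := by
    calc ⟪W k σ, tableA α (W (k - 1) σ)⟫ ≤ ‖W k σ‖ * ‖tableA α (W (k - 1) σ)‖ :=
          real_inner_le_norm _ _
      _ ≤ u * (fluxConst α * ‖W (k - 1) σ‖ ^ 2) :=
          mul_le_mul_of_nonneg_left (hS.normA _) hu0
      _ ≤ u * (fluxConst α * M ^ 2) := by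
          apply mul_le_mul_of_nonneg_left _ hu0
          exact mul_le_mul_of_nonneg_left (pow_le_pow_left₀ (norm_nonneg _) hM 2) hCA
  set b : ℝ := 2 * bigLam ε₀ * fluxConst α * M ^ 2 with hb
  have hfeed' : 2 * bigLam ε₀ * ⟪W k σ, tableA α (W (k - 1) σ)⟫ ≤ b * u := by
    have := mul_le_mul_of_nonneg_left hfeed (by positivity : (0:ℝ) ≤ 2 * bigLam ε₀)
    calc 2 * bigLam ε₀ * ⟪W k σ, tableA α (W (k - 1) σ)⟫
        ≤ 2 * bigLam ε₀ * (u * (fluxConst α * M ^ 2)) := this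
      _ = b * u := by rw [hb]; ring
  have hback : 0 ≤ 2 * (bigLam ε₀)⁻¹ * ⟪W (k + 1) σ, tableA α (W k σ)⟫ := by positivity
  have hvisc : 0 ≤ 2 * viscCoef ε₀ νh k σ * ‖W k σ‖ ^ 2 := by
    have hvc : 0 ≤ viscCoef ε₀ νh k σ := by
      unfold viscCoef
      have : 0 < (1 + ε₀) ^ ((2 : ℝ) * k) := Real.rpow_pos_of_pos (by linarith) _
      positivity
    positivity
  have hnorm : ‖W k σ‖ ^ 2 = u ^ 2 := by rw [hu]
  rw [hnorm]
  rw [hnorm] at hvisc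
  nlinarith [sq_nonneg (u - b), hfeed', hback, hvisc]

/-! ## The fence and the slaving to the shell below -/

/-- **THE FENCE.**  Let `W` be an admissible eternal solution with covariant viscosity of a cancelling table,
`k` a shell, `σ₁` a log-time and `b ≥ 0`.  If the half-damped bracket of shell `k` is `≤ b²` on `(-∞, σ₁]`
and the shell is bounded there, then `‖W_k(σ)‖ ≤ b` for every `σ ≤ σ₁`: `e^{σ}‖W_k(σ)‖² - b² e^{σ}` is
antitone on `(-∞, σ₁]` and tends to `0` as `σ → -∞` (eternity + boundedness release the fence).
[cite: Tao2016AveragedNS, §4 (4.1), (4.3), Lemma 4.1 (4.8); §6.4 (self-similar variables)] -/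
theorem norm_le_of_bracket_le (hW : IsEternalVisc ε₀ νh α W) (hc : IsCancellingCoeff α)
    {k : ℤ} {σ₁ b D : ℝ} (hb0 : 0 ≤ b)
    (hbr : ∀ x, x ≤ σ₁ → -‖W k x‖ ^ 2 + 2 * bigLam ε₀ * ⟪W k x, tableA α (W (k - 1) x)⟫
        - 2 * (bigLam ε₀)⁻¹ * ⟪W (k + 1) x, tableA α (W k x)⟫
        - 2 * viscCoef ε₀ νh k x * ‖W k x‖ ^ 2 ≤ b ^ 2)
    (hD : ∀ s, s ≤ σ₁ → ‖W k s‖ ≤ D) :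
    ∀ σ, σ ≤ σ₁ → ‖W k σ‖ ≤ b := by
  set g : ℝ → ℝ := fun x => Real.exp (1 * x) * ‖W k x‖ ^ 2 - b ^ 2 * Real.exp x with hg
  have hderiv : ∀ x, HasDerivAt g
      (Real.exp (1 * x) * ((1 - 2) * ‖W k x‖ ^ 2 + 2 * bigLam ε₀ * ⟪W k x, tableA α (W (k - 1) x)⟫
        - 2 * (bigLam ε₀)⁻¹ * ⟪W (k + 1) x, tableA α (W k x)⟫
        - 2 * viscCoef ε₀ νh k x * ‖W k x‖ ^ 2) - b ^ 2 * Real.exp x) x := by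
    intro x
    exact (hasDerivAt_expWeight hW hc 1 k x).sub ((Real.hasDerivAt_exp x).const_mul (b ^ 2))
  have hdiff : Differentiable ℝ g := fun x => (hderiv x).differentiableAt
  have hanti : AntitoneOn g (Iic σ₁) := by
    apply antitoneOn_of_deriv_nonpos (convex_Iic σ₁) hdiff.continuous.continuousOn
      (hdiff.differentiableOn.mono interior_subset)
    intro x hx
    rw [interior_Iic] at hx
    rw [(hderiv x).deriv]
    have h1 : (1 - 2 : ℝ) * ‖W k x‖ ^ 2 = -‖W k x‖ ^ 2 := by ring
    rw [h1, one_mul]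
    have hex : 0 ≤ Real.exp x := (Real.exp_pos x).le
    nlinarith [mul_le_mul_of_nonneg_left (hbr x (le_of_lt hx)) hex]
  -- release the fence from the far past
  intro σ hσ
  have hgle : ∀ a, a ≤ σ → g σ ≤ Real.exp a * D ^ 2 := by
    intro a ha
    have h1 : g σ ≤ g a := hanti (show a ∈ Iic σ₁ from ha.trans hσ) (show σ ∈ Iic σ₁ from hσ) ha
    refine h1.trans ?_
    have h2 : ‖W k a‖ ^ 2 ≤ D ^ 2 := pow_le_pow_left₀ (norm_nonneg _) (hD a (ha.trans hσ)) 2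
    have h3 : 0 ≤ b ^ 2 * Real.exp a := by positivity
    simp only [hg, one_mul]
    nlinarith [mul_le_mul_of_nonneg_left h2 (Real.exp_pos a).le]
  have hlim : Tendsto (fun a => Real.exp a * D ^ 2) atBot (𝓝 0) := by
    have := Real.tendsto_exp_atBot.mul_const (D ^ 2)
    simpa using this
  have hg0 : g σ ≤ 0 :=
    ge_of_tendsto hlim (eventually_atBot.2 ⟨σ, fun a ha => hgle a ha⟩)
  have h4 : Real.exp σ * ‖W k σ‖ ^ 2 ≤ Real.exp σ * b ^ 2 := by
    simp only [hg, one_mul] at hg0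
    linarith
  have h5 : ‖W k σ‖ ^ 2 ≤ b ^ 2 := le_of_mul_le_mul_left h4 (Real.exp_pos σ)
  exact (pow_le_pow_iff_left₀ (norm_nonneg _) hb0 two_ne_zero).1 h5

/-- **SLAVING TO THE SHELL BELOW (past-local, any `ν̂ ≥ 0`, no sign hypothesis).**  If on `(-∞, σ₁]` the
shell below obeys `‖W_{k-1}‖ ≤ M`, the shell above obeys the backscatter margin `4 C_A ‖W_{k+1}‖ ≤ Λ`, and
the shell itself is bounded, then `‖W_k(σ)‖ ≤ 2 Λ C_A M²` for every `σ ≤ σ₁`.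
[cite: Tao2016AveragedNS, §4 (4.1), (4.3), Lemma 4.1 (4.8); §6.4 (self-similar variables)] -/
theorem norm_le_slaved (hε : 0 < ε₀) (hW : IsEternalVisc ε₀ νh α W) (hc : IsCancellingCoeff α)
    {k : ℤ} {σ₁ M D : ℝ} (hM : ∀ s, s ≤ σ₁ → ‖W (k - 1) s‖ ≤ M)
    (hmar : ∀ s, s ≤ σ₁ → 4 * fluxConst α * ‖W (k + 1) s‖ ≤ bigLam ε₀)
    (hD : ∀ s, s ≤ σ₁ → ‖W k s‖ ≤ D) :
    ∀ σ, σ ≤ σ₁ → ‖W k σ‖ ≤ 2 * bigLam ε₀ * fluxConst α * M ^ 2 := by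
  have hΛ : 0 < bigLam ε₀ := bigLam_pos (by linarith)
  have hCA : 0 ≤ fluxConst α := fluxConst_nonneg α
  exact norm_le_of_bracket_le hW hc (by positivity)
    (fun x hx => bracket_le hε hW.nonneg hc (hM x hx) (hmar x hx)) hD

/-- **Slaving, upward-flux form.**  If the bond above shell `k` never backscatters on `(-∞, σ₁]`
(`⟪W_{k+1}, A W_k⟫ ≥ 0`), then `‖W_k(σ)‖ ≤ 2 Λ C_A M²` on `(-∞, σ₁]` whenever `‖W_{k-1}‖ ≤ M` there and
the shell is bounded in the past — no margin needed.
[cite: Tao2016AveragedNS, §4 (4.1), (4.3), Lemma 4.1 (4.8)–(4.9); §1.2] -/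
theorem norm_le_slaved_of_flux_nonneg (hε : 0 < ε₀) (hW : IsEternalVisc ε₀ νh α W)
    (hc : IsCancellingCoeff α) {k : ℤ} {σ₁ M D : ℝ}
    (hM : ∀ s, s ≤ σ₁ → ‖W (k - 1) s‖ ≤ M)
    (hflux : ∀ s, s ≤ σ₁ → 0 ≤ ⟪W (k + 1) s, tableA α (W k s)⟫)
    (hD : ∀ s, s ≤ σ₁ → ‖W k s‖ ≤ D) :
    ∀ σ, σ ≤ σ₁ → ‖W k σ‖ ≤ 2 * bigLam ε₀ * fluxConst α * M ^ 2 := by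
  have hΛ : 0 < bigLam ε₀ := bigLam_pos (by linarith)
  have hCA : 0 ≤ fluxConst α := fluxConst_nonneg α
  exact norm_le_of_bracket_le hW hc (by positivity)
    (fun x hx => bracket_le_of_flux_nonneg hε hW.nonneg hc (hM x hx) (hflux x hx)) hD

/-! ## The sign-free growth bound -/

/-- **Sign-free growth bound** under the uniform bound `‖W‖ ≤ B`: for `x ≤ r`,
`‖W_k(r)‖² ≤ ‖W_k(x)‖² + L (r - x)` with `L = 2 C_A (Λ + Λ⁻¹) B³` (feed and back-reaction bounded by the
uniform bound; the damping and the dissipation have a sign).  Uniform in the shell `k` and in `ν̂ ≥ 0` —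
unlike a Lipschitz bound, which the covariant viscosity `ν̂ (1+ε₀)^{2k} e^{-σ}` forbids.
[cite: Tao2016AveragedNS, §4 (4.1), (4.3), Lemma 4.1 (4.8); §6.4] -/
theorem normSq_le_add_mul (hε : 0 < ε₀) (hW : IsEternalVisc ε₀ νh α W) (hc : IsCancellingCoeff α)
    {B : ℝ} (hB : ∀ (k : ℤ) (σ : ℝ), ‖W k σ‖ ≤ B) (k : ℤ) {x r : ℝ} (hxr : x ≤ r) :
    ‖W k r‖ ^ 2 ≤ ‖W k x‖ ^ 2
      + (2 * fluxConst α * (bigLam ε₀ + (bigLam ε₀)⁻¹) * B ^ 3) * (r - x) := by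
  have hΛ : 0 < bigLam ε₀ := bigLam_pos (by linarith)
  have hCA : 0 ≤ fluxConst α := fluxConst_nonneg α
  have hS := table_sTable α hc
  have hB0 : 0 ≤ B := (norm_nonneg _).trans (hB k x)
  set L : ℝ := 2 * fluxConst α * (bigLam ε₀ + (bigLam ε₀)⁻¹) * B ^ 3 with hL
  -- the bracket with weight e^{0·σ}
  have hbr : ∀ y, (0 - 2) * ‖W k y‖ ^ 2 + 2 * bigLam ε₀ * ⟪W k y, tableA α (W (k - 1) y)⟫
        - 2 * (bigLam ε₀)⁻¹ * ⟪W (k + 1) y, tableA α (W k y)⟫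
        - 2 * viscCoef ε₀ νh k y * ‖W k y‖ ^ 2 ≤ L := by
    intro y
    have hfeed : ⟪W k y, tableA α (W (k - 1) y)⟫ ≤ B * (fluxConst α * B ^ 2) := by
      calc ⟪W k y, tableA α (W (k - 1) y)⟫ ≤ ‖W k y‖ * ‖tableA α (W (k - 1) y)‖ :=
            real_inner_le_norm _ _
        _ ≤ ‖W k y‖ * (fluxConst α * ‖W (k - 1) y‖ ^ 2) :=
            mul_le_mul_of_nonneg_left (hS.normA _) (norm_nonneg _)
        _ ≤ B * (fluxConst α * B ^ 2) := by
            apply mul_le_mul (hB k y) _ (by positivity) hB0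
            exact mul_le_mul_of_nonneg_left (pow_le_pow_left₀ (norm_nonneg _) (hB (k-1) y) 2) hCA
    have hback : -⟪W (k + 1) y, tableA α (W k y)⟫ ≤ B * (fluxConst α * B ^ 2) := by
      calc -⟪W (k + 1) y, tableA α (W k y)⟫ ≤ |⟪W (k + 1) y, tableA α (W k y)⟫| := neg_le_abs _
        _ ≤ ‖W (k + 1) y‖ * ‖tableA α (W k y)‖ := abs_real_inner_le_norm _ _
        _ ≤ ‖W (k + 1) y‖ * (fluxConst α * ‖W k y‖ ^ 2) :=
            mul_le_mul_of_nonneg_left (hS.normA _) (norm_nonneg _)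
        _ ≤ B * (fluxConst α * B ^ 2) := by
            apply mul_le_mul (hB (k+1) y) _ (by positivity) hB0
            exact mul_le_mul_of_nonneg_left (pow_le_pow_left₀ (norm_nonneg _) (hB k y) 2) hCA
    have hvisc : 0 ≤ 2 * viscCoef ε₀ νh k y * ‖W k y‖ ^ 2 := by
      have hν := hW.nonneg
      have hvc : 0 ≤ viscCoef ε₀ νh k y := by
        unfold viscCoef
        have : 0 < (1 + ε₀) ^ ((2 : ℝ) * k) := Real.rpow_pos_of_pos (by linarith) _
        positivity
      positivity
    have h1 : 2 * bigLam ε₀ * ⟪W k y, tableA α (W (k - 1) y)⟫ ≤ 2 * bigLam ε₀ * (B * (fluxConst α * B ^ 2)) :=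
      mul_le_mul_of_nonneg_left hfeed (by positivity)
    have h2 : -(2 * (bigLam ε₀)⁻¹ * ⟪W (k + 1) y, tableA α (W k y)⟫)
        ≤ 2 * (bigLam ε₀)⁻¹ * (B * (fluxConst α * B ^ 2)) := by
      have := mul_le_mul_of_nonneg_left hback (by positivity : (0:ℝ) ≤ 2 * (bigLam ε₀)⁻¹)
      linarith
    have h3 : 0 ≤ ‖W k y‖ ^ 2 := by positivity
    have hLe : L = 2 * bigLam ε₀ * (B * (fluxConst α * B ^ 2))
        + 2 * (bigLam ε₀)⁻¹ * (B * (fluxConst α * B ^ 2)) := by rw [hL]; ring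
    rw [hLe]
    linarith
  -- the antitone fence h(y) = ‖W k y‖² - L y
  set h : ℝ → ℝ := fun y => Real.exp (0 * y) * ‖W k y‖ ^ 2 - L * y with hh
  have hderiv : ∀ y, HasDerivAt h
      (Real.exp (0 * y) * ((0 - 2) * ‖W k y‖ ^ 2 + 2 * bigLam ε₀ * ⟪W k y, tableA α (W (k - 1) y)⟫
        - 2 * (bigLam ε₀)⁻¹ * ⟪W (k + 1) y, tableA α (W k y)⟫
        - 2 * viscCoef ε₀ νh k y * ‖W k y‖ ^ 2) - L * 1) y := by
    intro y
    exact (hasDerivAt_expWeight hW hc 0 k y).sub ((hasDerivAt_id y).const_mul L)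
  have hdiff : Differentiable ℝ h := fun y => (hderiv y).differentiableAt
  have hanti : Antitone h := by
    apply antitone_of_deriv_nonpos hdiff
    intro y
    rw [(hderiv y).deriv]
    simp only [zero_mul, Real.exp_zero, one_mul, mul_one]
    linarith [hbr y]
  have hxy := hanti hxr
  simp only [hh, zero_mul, Real.exp_zero, one_mul] at hxy
  linarith

end Summit.NavierStokesRegularity.NavierStokesRegularity.Theorems.NoSurvivingEternalViscBddOne.TailBarrier

end
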